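import Mathlib

/-!
# The anti-diagonal flow polynomial multiplies under parallel composition
(seat mine-b, cell pub-perc-repro2; conjectures/MINE-B.md §18.7)

For a weighted state family (index type `ι`, weights `w`, red level `r`, blue level `b` — for a pattern
`(O, Y)`: the colourings, the counting measure, `F_R`, `F_B`) the **anti-diagonal flow polynomial** is
  `h(μ) = Σ_x w x · μ^{r x} · (1 − μ)^{b x}`
(the bivariate generating function of the joint flow law restricted to the line `μ + λ = 1`).  Its
derivative at `0` is `#{F_R = 1} − Σ_{F_R = 0} F_B`, the quantity of the level-summed row (U)
(FlowSumClosure.lean), and conjecture (H) of MINE-B.md §18.7 says that `h` is non-decreasing on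
`[0, 1/2]`.  Here: under parallel composition (flows add on the product of the configuration sets)
the polynomial MULTIPLIES (`hpoly_par`), it is non-negative on `[0, 1]` for non-negative weights
(`hpoly_nonneg`), and hence (H) is closed under parallel composition (`monotoneOn_hpoly_par`).
-/

namespace Summit.Ventures.PercRepro2

namespace FlowPoly

open Finset

variable {ι : Type*} [Fintype ι]

/-- the anti-diagonal flow polynomial `h(μ) = Σ_x w x · μ^{r x} · (1 − μ)^{b x}` -/
def hpoly (w : ι → ℝ) (r b : ι → ℕ) (μ : ℝ) : ℝ :=
  ∑ x, w x * (μ ^ r x * (1 - μ) ^ b x)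

/-- `h` is non-negative on `[0, 1]` for non-negative weights -/
theorem hpoly_nonneg (w : ι → ℝ) (r b : ι → ℕ) (hw : ∀ x, 0 ≤ w x) {μ : ℝ} (h0 : 0 ≤ μ)
    (h1 : μ ≤ 1) : 0 ≤ hpoly w r b μ := by
  unfold hpoly
  refine Finset.sum_nonneg (fun x _ => mul_nonneg (hw x) (mul_nonneg (pow_nonneg h0 _) ?_))
  exact pow_nonneg (by linarith) _

/-- **parallel composition multiplies the polynomials**: on the product family with added levels,
`h_{F ∥ G} = h_F · h_G` -/
theorem hpoly_par {ι₁ ι₂ : Type*} [Fintype ι₁] [Fintype ι₂] (w₁ : ι₁ → ℝ) (r₁ b₁ : ι₁ → ℕ)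
    (w₂ : ι₂ → ℝ) (r₂ b₂ : ι₂ → ℕ) (μ : ℝ) :
    hpoly (fun p : ι₁ × ι₂ => w₁ p.1 * w₂ p.2) (fun p => r₁ p.1 + r₂ p.2)
        (fun p => b₁ p.1 + b₂ p.2) μ
      = hpoly w₁ r₁ b₁ μ * hpoly w₂ r₂ b₂ μ := by
  unfold hpoly
  rw [Fintype.sum_prod_type, Finset.sum_mul_sum]
  refine Finset.sum_congr rfl (fun x _ => Finset.sum_congr rfl (fun y _ => ?_))
  rw [pow_add, pow_add]
  ring

/-- **(H) is closed under parallel composition**: if both polynomials are non-decreasing on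
`[0, 1/2]` (and the weights are non-negative) then so is the polynomial of the parallel product. -/
theorem monotoneOn_hpoly_par {ι₁ ι₂ : Type*} [Fintype ι₁] [Fintype ι₂] {w₁ : ι₁ → ℝ}
    {r₁ b₁ : ι₁ → ℕ} {w₂ : ι₂ → ℝ} {r₂ b₂ : ι₂ → ℕ} (hw₁ : ∀ x, 0 ≤ w₁ x) (hw₂ : ∀ y, 0 ≤ w₂ y)
    (h₁ : MonotoneOn (hpoly w₁ r₁ b₁) (Set.Icc 0 (1 / 2)))
    (h₂ : MonotoneOn (hpoly w₂ r₂ b₂) (Set.Icc 0 (1 / 2))) :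
    MonotoneOn (hpoly (fun p : ι₁ × ι₂ => w₁ p.1 * w₂ p.2) (fun p => r₁ p.1 + r₂ p.2)
      (fun p => b₁ p.1 + b₂ p.2)) (Set.Icc 0 (1 / 2)) := by
  have heq : hpoly (fun p : ι₁ × ι₂ => w₁ p.1 * w₂ p.2) (fun p => r₁ p.1 + r₂ p.2)
      (fun p => b₁ p.1 + b₂ p.2) = hpoly w₁ r₁ b₁ * hpoly w₂ r₂ b₂ := by
    funext μ
    exact hpoly_par w₁ r₁ b₁ w₂ r₂ b₂ μ
  rw [heq]
  refine MonotoneOn.mul h₁ h₂ (fun μ hμ => ?_) (fun μ hμ => ?_)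
  · exact hpoly_nonneg w₁ r₁ b₁ hw₁ hμ.1 (by linarith [hμ.2])
  · exact hpoly_nonneg w₂ r₂ b₂ hw₂ hμ.1 (by linarith [hμ.2])

/-- the derivative of one term `μ ↦ μ^i (1 − μ)^j` -/
theorem hasDerivAt_term (i j : ℕ) (μ : ℝ) :
    HasDerivAt (fun μ : ℝ => μ ^ i * (1 - μ) ^ j)
      ((i : ℝ) * μ ^ (i - 1) * (1 - μ) ^ j + μ ^ i * ((j : ℝ) * (1 - μ) ^ (j - 1) * (-1))) μ := by
  have h1 : HasDerivAt (fun μ : ℝ => μ ^ i) ((i : ℝ) * μ ^ (i - 1)) μ := hasDerivAt_pow i μ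
  have h2 : HasDerivAt (fun μ : ℝ => (1 - μ) ^ j) ((j : ℝ) * (1 - μ) ^ (j - 1) * (-1)) μ := by
    have h3 : HasDerivAt (fun μ : ℝ => 1 - μ) (-1) μ := (hasDerivAt_id μ).const_sub 1
    exact (hasDerivAt_pow j (1 - μ)).comp μ h3
  exact h1.mul h2

/-- the derivative of `h` -/
theorem hasDerivAt_hpoly (w : ι → ℝ) (r b : ι → ℕ) (μ : ℝ) :
    HasDerivAt (hpoly w r b)
      (∑ x, w x * ((r x : ℝ) * μ ^ (r x - 1) * (1 - μ) ^ b x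
        + μ ^ r x * ((b x : ℝ) * (1 - μ) ^ (b x - 1) * (-1)))) μ := by
  have h := HasDerivAt.sum (u := (Finset.univ : Finset ι))
    (fun x _ => (hasDerivAt_term (r x) (b x) μ).const_mul (w x))
  refine h.congr_of_eventuallyEq (Filter.Eventually.of_forall (fun y => ?_))
  simp only [hpoly, Finset.sum_apply]

/-- **`h′(0)` is the quantity of the row (U)**: `h′(0) = Σ_x w x · ([r x = 1] − [r x = 0] · b x)`
(`= FlowSum.uval w r b`, FlowSumClosure.lean) -/
theorem deriv_hpoly_zero (w : ι → ℝ) (r b : ι → ℕ) :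
    deriv (hpoly w r b) 0
      = ∑ x, w x * ((if r x = 1 then (1 : ℝ) else 0) - (if r x = 0 then (b x : ℝ) else 0)) := by
  rw [(hasDerivAt_hpoly w r b 0).deriv]
  refine Finset.sum_congr rfl (fun x _ => ?_)
  congr 1
  rcases Nat.lt_trichotomy (r x) 1 with h | h | h
  · have h0 : r x = 0 := by omega
    simp [h0]
  · simp [h]
  · have h1 : r x ≠ 1 := by omega
    have h0 : r x ≠ 0 := by omega
    have h2 : r x - 1 ≠ 0 := by omega
    simp [h0, h1, zero_pow h2, zero_pow h0]

end FlowPoly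

end Summit.Ventures.PercRepro2
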